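import Summits.CriticalPhenomena.CardyFormulaZ2.Theorems.CardyComplexConeEdgePrecompactUFRSRectArcNear

/-!
# The deep double junction: one strand-crossing already costs a genuine arm (S0 of HJ-S)
(line `qkz-strip-boundary-arm` of crux `CardyComplexCone.EdgePrecompact`, stmt-CriticalPhenomena-11387;
registered sub-goal S0 = `ufrs_junction_deepPair_le`, the third input of the landed assembly
`ufrs_junction_scale_le_of_gate` of the per-scale junction bound HJ-S, lead c5 wave 3)

**Theorem** (`ufrs_junction_deepPair_le`). For an axis-parallel rectangle `D` there are `K₁ ≥ 2`,
`R₁ > 0` and `η₀ > 0` such that for `0 < η < η₀` there is `δ₀ > 0` with: for all `ℤ²`-admissible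
data `E` of `D` with `E.δ < δ₀`, all shifts `‖E.δ w‖ < η`, every point `z` and radius `r` with
`η ≤ r`, `K₁ r ≤ R₁`, if ALL marked (`A`–`B`) midpoints of `E` and of `shiftData E w` lie within
`r / K₁` of `z`, then `P_{1/2}(ufrsStrands E w z 1 r (K₁ r)) ≤ 1/2`.

Proof. Both marked midpoints of `E` within `ρ = r/K₁` of `z` put one whole arc of `E` within
`10ρ + 22δ ≤ r - 2δ` of `z` (`ufrs_rect_arcNear_of_markedNear`, `…UFRSRectArcNear.lean`; `K₁ ≥ 32`,
`64δ ≤ r`), and likewise for the translate (an admissible datum of the translated rectangle,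
`isZdAdmissible_shiftData`, `vadd_rect_ONE`); this is the monochromatic-band hypothesis of
`real_ufrsStrands_one_le_of_mono` (`…UFRSOneStrandGenuine.lean`: one strand-crossing of
`A(z; r, K₁ r)` is a genuine open crossing of `A(z; r, K₁ r)` or dual crossing of
`A(z; r + 2δ, K₁ r - 2δ)` of `ω`), and the RSW one-arm bounds (`real_open_add_dual_le`) give
`P ≤ 2 (4/K₁)^α ≤ 1/2` for `K₁ ≥ 4 · 4^{1/α}`, `α = min α_o α_d`.

References: S. Smirnov, C. R. Acad. Sci. Paris 333 (2001), §2; G. Grimmett, *Percolation* (1999),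
§11.8 (one-arm bound); B. Bollobás, O. Riordan, *Percolation* (2006), Ch. 7, Lemma 4.
-/


namespace Summit.CriticalPhenomena.CardyFormulaZ2.Cruxes.EdgePrecompact.QkzStripBoundaryArm

open MeasureTheory Filter Set Metric
open scoped Topology BigOperators Pointwise
open Literature.Probability.LatticeModels Literature.Probability.Percolation
open Literature.Probability.RandomPlanarGeometry (DobrushinDomain)
open Summit.CriticalPhenomena.CardyFormulaZ2.Theses.CardyComplexCone

noncomputable section

/-- **The monochromatic band of a deep double junction.** For `ℤ²`-admissible data `F` of an open
rectangle with both marked midpoints within `r / K₁` of `z` (`32 ≤ K₁`, `64 F.δ ≤ r`,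
`2 (r / K₁) + 8 F.δ ≤` both sides): no site of `F.zdArcA`, or no site of `F.zdArcB`, has its mesh
point at distance `> r - 2 F.δ` from `z` (the hypothesis of `real_ufrsStrands_one_le_of_mono` for the
band `(r - 2δ, K₁ r + 2δ)`). -/
theorem monoBand_deep_HJ {F : DiscreteDobrushin} {x₀ x₁ y₀ y₁ : ℝ} (hx : x₀ < x₁) (hy : y₀ < y₁)
    (hFΩ : F.Ω = Set.Ioo x₀ x₁ ×ℂ Set.Ioo y₀ y₁) (hF : F.IsZdAdmissible) {z : ℂ} {r K₁ : ℝ} (hK : 32 ≤ K₁)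
    (hr : 64 * F.δ ≤ r) (hsmall : 2 * (r / K₁) + 8 * F.δ ≤ min (x₁ - x₀) (y₁ - y₀))
    (hnear : ∀ e ∈ F.zdABEdges, dist (medialPoint F.δ e) z ≤ r / K₁) :
    (∀ x ∈ F.zdArcA, dist (meshPoint F.δ x) z ≤ r - 2 * F.δ ∨ K₁ * r + 2 * F.δ ≤ dist (meshPoint F.δ x) z) ∨
      (∀ x ∈ F.zdArcB, dist (meshPoint F.δ x) z ≤ r - 2 * F.δ ∨ K₁ * r + 2 * F.δ ≤ dist (meshPoint F.δ x) z) := by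
  have hδ := hF.delta_pos
  have hrpos : 0 < r := by linarith
  have hKpos : 0 < K₁ := by linarith
  have hρ : 0 ≤ r / K₁ := by positivity
  have hρle : r / K₁ ≤ r / 32 := div_le_div_of_nonneg_left hrpos.le (by norm_num) hK
  have hbound : 10 * (r / K₁) + 22 * F.δ ≤ r - 2 * F.δ := by linarith
  rcases ufrs_rect_arcNear_of_markedNear F x₀ x₁ y₀ y₁ hx hy hFΩ hF z (r / K₁) hρ hsmall hnear with h | h
  · exact Or.inl fun x hxA => Or.inl ((h x hxA).trans hbound)
  · exact Or.inr fun x hxB => Or.inl ((h x hxB).trans hbound)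

/-- **S0: at a deep double junction one strand-crossing has probability `≤ 1/2`** (registered
sub-goal `ufrs_junction_deepPair_le` of stmt-CriticalPhenomena-11387, input S0 of
`ufrs_junction_scale_le_of_gate`). See the module docstring. -/
theorem ufrs_junction_deepPair_le : ∀ (D : DobrushinDomain), (∃ x₀ x₁ y₀ y₁ : ℝ, x₀ < x₁ ∧ y₀ < y₁ ∧ D.carrier = Set.Ioo x₀ x₁ ×ℂ Set.Ioo y₀ y₁) → ∃ (K₁ R₁ : ℝ), 2 ≤ K₁ ∧ 0 < R₁ ∧ ∃ η₀ > (0:ℝ), ∀ η : ℝ, 0 < η → η < η₀ → ∃ δ₀ > (0:ℝ), ∀ E : DiscreteDobrushin, E.Ω = D.carrier → E.IsZdAdmissible → E.δ < δ₀ → ∀ w : Site 2, ‖meshPoint E.δ w‖ < η → ∀ (z : ℂ) (r : ℝ), η ≤ r → K₁ * r ≤ R₁ → (∀ e : Sym2 (Site 2), (e ∈ E.zdABEdges ∨ e ∈ (shiftData E w).zdABEdges) → dist (medialPoint E.δ e) z ≤ r / K₁) → (bondPercolation (zdGraph 2) half).real (ufrsStrands E w z 1 r (K₁ * r)) ≤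 1 / 2 := by
  intro D hD
  obtain ⟨x₀, x₁, y₀, y₁, hx, hy, hcar⟩ := hD
  obtain ⟨αo, co, hαo, hco, ho⟩ := annulusOpenCrossing_half_le_holds
  obtain ⟨αd, cd, hαd, hcd, hd⟩ := annulusDualCrossing_half_le_holds
  have hα : 0 < min αo αd := lt_min hαo hαd
  -- the ratio `K₁`: `(4 / K₁)^α ≤ 1/4`
  set t : ℝ := (1 / 4 : ℝ) ^ (1 / min αo αd) with ht
  have htpos : 0 < t := Real.rpow_pos_of_pos (by norm_num) _
  set K₁ : ℝ := max 32 (4 / t) with hK₁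
  have hK32 : (32 : ℝ) ≤ K₁ := le_max_left _ _
  have hKpos : 0 < K₁ := by linarith
  have hKt : 4 / K₁ ≤ t := by
    rw [div_le_iff₀ hKpos]
    have h1 : 4 / t ≤ K₁ := le_max_right _ _
    rw [div_le_iff₀ htpos] at h1
    linarith
  have hpow : (4 / K₁) ^ min αo αd ≤ 1 / 4 := by
    calc (4 / K₁) ^ min αo αd ≤ t ^ min αo αd := Real.rpow_le_rpow (by positivity) hKt hα.le
      _ = 1 / 4 := by
          rw [ht, ← Real.rpow_mul (by norm_num : (0:ℝ) ≤ 1 / 4), one_div_mul_cancel hα.ne', Real.rpow_one]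
  -- the geometric constants
  set L : ℝ := min (x₁ - x₀) (y₁ - y₀) with hL
  have hLpos : 0 < L := lt_min (by linarith) (by linarith)
  refine ⟨K₁, L / 16, by linarith, by positivity, L / 16, by positivity, fun η hη hηL => ?_⟩
  refine ⟨η / (co + cd + 64), by positivity, fun E hEΩ hE hδ w hw z r hηr hKr hnear => ?_⟩
  set μ := bondPercolation (zdGraph 2) half with hμ
  have hδpos : 0 < E.δ := hE.delta_pos
  have hEΩ' : E.Ω = Set.Ioo x₀ x₁ ×ℂ Set.Ioo y₀ y₁ := hEΩ.trans hcar
  -- mesh bookkeeping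
  have hδη : (co + cd + 64) * E.δ < η := by
    have h := (lt_div_iff₀ (by positivity : (0:ℝ) < co + cd + 64)).1 hδ
    linarith
  have hrpos : 0 < r := lt_of_lt_of_le hη hηr
  have hcoδ0 : 0 ≤ co * E.δ := by positivity
  have hcdδ0 : 0 ≤ cd * E.δ := by positivity
  have hcoδ : co * E.δ ≤ r := by linarith
  have hcdδ : cd * E.δ ≤ r := by linarith
  have h64 : 64 * E.δ ≤ r := by linarith
  have h2δ : 2 * E.δ ≤ r := by linarith
  have hρle : r / K₁ ≤ r / 32 := div_le_div_of_nonneg_left hrpos.le (by norm_num) hK32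
  have hsmall : 2 * (r / K₁) + 8 * E.δ ≤ L := by
    have h1 : K₁ * r ≤ L / 16 := hKr
    have h2 : r ≤ K₁ * r := by nlinarith
    have h3 : E.δ ≤ L / 16 := by linarith
    linarith
  -- the monochromatic bands of `E` and of its translate
  have hmonoE := monoBand_deep_HJ hx hy hEΩ' hE hK32 h64 hsmall (fun e he => hnear e (Or.inl he))
  set u : ℂ := meshPoint E.δ w with hu
  have hFΩ : (shiftData E w).Ω = Set.Ioo (u.re + x₀) (u.re + x₁) ×ℂ Set.Ioo (u.im + y₀) (u.im + y₁) := by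
    rw [shiftData_Ω, hEΩ', vadd_rect_ONE]
  have hsmall' : 2 * (r / K₁) + 8 * E.δ ≤ min (u.re + x₁ - (u.re + x₀)) (u.im + y₁ - (u.im + y₀)) := by
    rw [show u.re + x₁ - (u.re + x₀) = x₁ - x₀ by ring, show u.im + y₁ - (u.im + y₀) = y₁ - y₀ by ring]
    exact hsmall
  have hmonoE' : (∀ x ∈ (shiftData E w).zdArcA, dist (meshPoint E.δ x) z ≤ r - 2 * E.δ ∨
        K₁ * r + 2 * E.δ ≤ dist (meshPoint E.δ x) z) ∨
      (∀ x ∈ (shiftData E w).zdArcB, dist (meshPoint E.δ x) z ≤ r - 2 * E.δ ∨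
        K₁ * r + 2 * E.δ ≤ dist (meshPoint E.δ x) z) :=
    monoBand_deep_HJ (F := shiftData E w) (by linarith) (by linarith) hFΩ (isZdAdmissible_shiftData E w hE) hK32 h64
      hsmall' (fun e he => hnear e (Or.inr he))
  -- genuine arm + RSW
  have hab : r + 4 * E.δ < K₁ * r := by nlinarith
  have h1 := real_ufrsStrands_one_le_of_mono hE w hab hmonoE hmonoE'
  have h2 := real_open_add_dual_le (z := z) ho hd hαo hαd hδpos hcoδ hcdδ h2δ (show 16 * r ≤ K₁ * r by nlinarith)
  have hratio : 4 * (r / (K₁ * r)) = 4 / K₁ := by field_simp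
  rw [hratio] at h2
  calc μ.real (ufrsStrands E w z 1 r (K₁ * r)) ≤ 2 * (4 / K₁) ^ min αo αd := h1.trans h2
    _ ≤ 2 * (1 / 4) := by linarith
    _ = 1 / 2 := by norm_num

end

end Summit.CriticalPhenomena.CardyFormulaZ2.Cruxes.EdgePrecompact.QkzStripBoundaryArm
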